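import Mathlib.RingTheory.Kaehler.Basic
import Mathlib.RingTheory.Localization.AtPrime.Basic
import Literature.AlgebraicGeometry.Resolution.ResolutionOfSingularities
import Literature.AlgebraicGeometry.Resolution.QuasiExcellentSchemes
import Literature.AlgebraicGeometry.Resolution.StrictNormalCrossings
import Literature.AlgebraicGeometry.CossartPiltant200819.Ramification2008
import HarnessLib

/-!
# Cossart–Piltant 2008/2009 — the threefold theorems (HAL Thm 2.1, Prop 4.9, Prop 5.1, [CP2] Main theorem) and the proved top-level reduction

V. Cossart, O. Piltant, *Resolution of singularities of threefolds in positive characteristic I*,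
J. Algebra 320 (2008) 1051–1082 (`CossartPiltant2008`, HAL hal-00139124 page numbers) and *II*,
J. Algebra 321 (2009) 1836–1976 (`CossartPiltant2009`). Named facts (statement level, Mathlib +
the tree's `Resolution.*` vocabulary; nothing asserted):

* `IsDifferentiallyFinite k` — "`k` differentially finite over a perfect field `k₀`, i.e.
  `Ω¹_{k/k₀}` has finite dimension" (Thm 2.1), with Mathlib's `Ω[k⁄k₀]`;
* `ResolutionAffineThreefolds` — **Theorem 2.1** (= [CP2] "Theorem" p. 1839) in the faithful
  AFFINE special case (Mathlib has neither quasi-projective schemes nor projective morphisms):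
  `Z = Spec A` reduced of finite type over `k` of dimension `≤ 3`, `π` proper birational from a
  regular scheme, an isomorphism over `Reg Z`, with snc exceptional locus — implied by the printed
  theorem (quasi-projective `Z`, projective `π`);
* `LU3DiffFinite` — the local uniformization theorem the two papers establish (HAL p. 3: "By
  proposition 4.9, it is sufficient to prove local uniformization …"; any `k` differentially
  finite of characteristic `p > 0`, `trdeg_k K = 3`);
* `RefinedPatching` — **Proposition 4.9** (refined patching, after Cossart 1992 [12]) on affine
  models, conclusion "isomorphism off the singular locus" (the tree's `CossartPiltant2019Patching`
  has the plain `HasResolution` conclusion on separated schemes of finite type);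
* `RankReduction` — **Proposition 5.1** (rank `> 1` or `κ(V)/k` transcendental; tree counterpart in
  the 2019 frame `Resolution.CossartPiltant2019Local.rankOne_reduction_of_cjs`, proved from CJS);
* `CossartPiltant2009Main` — [CP2]'s Main theorem, AS the hypothesis of [CP1] Thm 7.2
  (`ArtinSchreierHypothesis k`) for `k` differentially finite (HAL pp. 3–4: "this is the main
  result of [CP2]");
* PROVED (bookkeeping of HAL pp. 3–4, 16): `isLocallyUniformizable_top` (the trivial valuation
  ring), `rank_trichotomy` (Hölder trichotomy via Mathlib's `RankLeOne`/`RankOne`),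
  `lu3_of_leaves : RankReduction → ReductionToArtinSchreier → CossartPiltant2009Main → LU3DiffFinite`,
  and `resolutionOfAffineModels_of_lu3 : LU3DiffFinite → RefinedPatching → ResolutionOfAffineModels`.

Deliberately NOT here: Props 4.1/4.2/4.4/4.7/4.8 (embedded resolution, principalization,
idealistic exponents, Abhyankar's and Zariski's theorems: `Resolution.CossartJannsenSaito2020Embedded`,
`Resolution.CossartPiltant2019Principalization`, `Resolution.CossartPiltant2008_prop44`,
`Resolution.AbhyankarQuadraticFactorization`), the CP-II case analysis (`Skeleton2009.lean`), and
the passage from `ResolutionOfAffineModels` + Prop 4.1 to (iii) of Thm 2.1 — the latter is now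
DONE downstream, in `Thm21Assembly2008.lean`:
`resolutionAffineThreefolds_of_resolutionOfAffineModels : ResolutionOfAffineModels →
CossartJannsenSaito2020General → CossartJannsenSaito2020Embedded → ResolutionAffineThreefolds`
(HAL p. 3, proof of Thm 2.1: induction on the irreducible components, [36] = Lipman 1978 in
dimension `≤ 2`, (iii) from Prop 4.1) and `resolutionAffineThreefolds_of_leaves`
(`ResolutionAffineThreefolds` from Prop 4.9, Prop 5.1, Cor 6.3, Prop 8.3, Prop 9.3, Lemma 9.4,
[CP2], [36] and Prop 4.1 — every leaf a named fact, none proved there).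
-/

noncomputable section

open CategoryTheory AlgebraicGeometry Polynomial

namespace Literature.AlgebraicGeometry.CossartPiltant200819.CP2008

open Literature.AlgebraicGeometry.Resolution

universe u

/-- `k` is **differentially finite over a perfect subfield** (Cossart–Piltant 2008, Thm 2.1 /
2009, Main theorem: "`k` … differentially finite over a perfect field `k₀`, i.e. `Ω¹_{k/k₀}` has
finite dimension"; Cossart–Piltant 2019 p. 3 writes the same class as "fields `k` with
`[k:k^p] < +∞`"). Rendered with Mathlib's Kähler differentials `Ω[k⁄k₀]` and `PerfectField k₀`;
`k₀` is quantified as a type with a ring map into `k`.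
[cite: CossartPiltant2008, Thm 2.1 (HAL p. 3, "differentially finite")] -/
def IsDifferentiallyFinite (k : Type u) [Field k] : Prop :=
  ∃ (k₀ : Type u) (_ : Field k₀) (_ : Algebra k₀ k), PerfectField k₀ ∧ Module.Finite k (Ω[k⁄k₀])

/-- **Cossart–Piltant 2008, Theorem 2.1** (HAL p. 3) = **Cossart–Piltant 2009, "Theorem"**
(p. 1839), VERBATIM: "Let `k` be a field of positive characteristic which is differentially finite
over a perfect field `k₀`, i.e. `Ω¹_{k/k₀}` has finite dimension. Let `Z/k` be a reduced
quasiprojective scheme of dimension three with singular locus `Σ`. There exists a projective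
morphism `π : Z̃ → Z`, such that (i) `Z̃` is regular. (ii) `π` induces an isomorphim
`Z̃∖π⁻¹(Σ) ≃ Z∖Σ`. (iii) `π⁻¹(Σ) ⊂ Z̃` is a divisor with strict normal crossings."
RENDERING (faithful special case — Mathlib has neither quasi-projective schemes nor projective
morphisms): `Z` AFFINE of finite type over `k` (affine ⇒ quasi-projective), reduced, of dimension
`≤ 3` (dimension `< 3`: the printed proof's first reduction, HAL p. 3 "Since the theorem is true in
dimension less than or equal to two [36]"); `π` proper birational from a regular scheme
(`Resolution.IsResolution`, weaker than projective); (ii) via `Resolution.Scheme.regularLocus`;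
(iii) via `Resolution.IsStrictNormalCrossingsDivisor`. This Prop is IMPLIED by the printed theorem.
[cite: CossartPiltant2008, Thm 2.1 (HAL p. 3)] -/
def ResolutionAffineThreefolds : Prop :=
  ∀ (p : ℕ) [Fact p.Prime] (k : Type u) [Field k] [CharP k p], IsDifferentiallyFinite k →
    ∀ (A : Type u) [CommRing A] [Algebra k A] [IsReduced A], Algebra.FiniteType k A →
      ringKrullDim A ≤ 3 →
      ∃ (X' : Scheme.{u}) (π : X' ⟶ Spec (.of A)), IsResolution π ∧
        (∃ U : (Spec (.of A)).Opens,
          (U : Set (Spec (.of A))) = Scheme.regularLocus (Spec (.of A)) ∧ IsIso (π ∣_ U)) ∧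
        IsStrictNormalCrossingsDivisor X' (π.base ⁻¹' (Scheme.regularLocus (Spec (.of A)))ᶜ)

/-- **The local uniformization theorem of Cossart–Piltant 2008/2009** (HAL p. 3, proof of Thm 2.1:
"By proposition 4.9, it is sufficient to prove local uniformization for any `k`-valuation ring
`V/k` of `K(Z)/k`", established by Prop 5.1, Thm 7.2 and [CP2]): for `k` differentially finite
over a perfect field, `char k = p > 0`, every `k`-valuation ring of every function field `K/k` of
transcendence degree three is locally uniformizable (`Resolution.IsLocallyUniformizable`). The
restriction of `Resolution.LocalUniformizationInChar p` to `trdeg 3` and differentially finite `k`;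
see `lu3_of_leaves` for its proved reduction to the paper's leaves.
[cite: CossartPiltant2008, Thm 2.1 (HAL p. 3, proof) and Prop 4.9 (hypothesis)] -/
def LU3DiffFinite : Prop :=
  ∀ (p : ℕ) [Fact p.Prime] (k : Type u) [Field k] [CharP k p], IsDifferentiallyFinite k →
    ∀ (K : Type u) [Field K] [Algebra k K], (⊤ : IntermediateField k K).FG →
      Algebra.trdeg k K = 3 →
      ∀ O : ValuationSubring K, (∀ c : k, algebraMap k K c ∈ O) → IsLocallyUniformizable k K O

/-- **Theorem 2.1 (i)(ii) on affine models of function fields** — the statement Prop 4.9 delivers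
once `LU3DiffFinite` is known: every affine model `Spec A` (`A ⊆ K` finitely generated over `k`,
`Frac A = K`) of a function field of transcendence degree three over a differentially finite `k`
has a resolution which is an isomorphism over `Reg (Spec A)`.
[cite: CossartPiltant2008, Thm 2.1 (HAL p. 3, proof) and Prop 4.9 (HAL pp. 15–16)] -/
def ResolutionOfAffineModels : Prop :=
  ∀ (p : ℕ) [Fact p.Prime] (k : Type u) [Field k] [CharP k p], IsDifferentiallyFinite k →
    ∀ (K : Type u) [Field K] [Algebra k K], (⊤ : IntermediateField k K).FG →
      Algebra.trdeg k K = 3 →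
      ∀ A : Subalgebra k K, A.FG → IsFractionRing A K →
        ∃ (X' : Scheme.{u}) (π : X' ⟶ Spec (.of A)), IsResolution π ∧
          ∃ U : (Spec (.of A)).Opens,
            (U : Set (Spec (.of A))) = Scheme.regularLocus (Spec (.of A)) ∧ IsIso (π ∣_ U)

/-- **Cossart–Piltant 2008, Proposition 4.9 (Refined patching theorem [12])** (HAL pp. 15–16),
VERBATIM: "Let `K/k` be a function field of transcendence degree three. Assume that any
`k`-valuation ring `V/k` such that `QF(V) = K` has a local uniformization. Then for any
quasiprojective model `Z/k` of `K/k`, there exists a projective birational morphism `π : Z̃ → Z`,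
such that `Z̃` is regular and `π` induces an isomorphim `Z̃∖π⁻¹(Σ) ≃ Z∖Σ`, where `Σ ⊂ Z` is the
singular locus of `Z`." ([12] = Cossart 1992, written for `k` algebraically closed "but only uses
this assumption via propositions 4.7 and 4.8", extended to any `k` by Prop 4.7 = Abhyankar [2]
Thm 3 = `Resolution.AbhyankarQuadraticFactorization` and Prop 4.8 = Zariski [46] Thm 7 via
Prop 4.2.) Any field `k` (§3 standing assumption `char k = p > 0` plays no role). RENDERED for
AFFINE models `Z = Spec A` and with `π` proper (weaker than projective), hence implied by the
printed proposition; compare `Resolution.CossartPiltant2019Patching` (separated `k`-schemes of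
finite type, conclusion `HasResolution` without the isomorphism clause, PROVED there from
principalization). [cite: CossartPiltant2008, Prop 4.9 (HAL pp. 15–16)] -/
def RefinedPatching : Prop :=
  ∀ (k K : Type u) [Field k] [Field K] [Algebra k K], (⊤ : IntermediateField k K).FG →
    Algebra.trdeg k K = 3 →
    (∀ O : ValuationSubring K, (∀ c : k, algebraMap k K c ∈ O) → IsLocallyUniformizable k K O) →
    ∀ A : Subalgebra k K, A.FG → IsFractionRing A K →
      ∃ (X' : Scheme.{u}) (π : X' ⟶ Spec (.of A)), IsResolution π ∧
        ∃ U : (Spec (.of A)).Opens,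
          (U : Set (Spec (.of A))) = Scheme.regularLocus (Spec (.of A)) ∧ IsIso (π ∣_ U)

/-- **Cossart–Piltant 2008, Proposition 5.1** (HAL p. 16), VERBATIM: "Let `K/k` be a function
field of dimension three and `V/k` be a `k`-valuation ring such that `QF(V) = K` and either `V`
has rank greater than one or `κ(V)/k` is transcendental. Then `V/k` has a local uniformization."
(Any `k` of characteristic `p > 0`; proof from resolution of excellent surfaces [36] = Lipman 1978
and composite valuations.) "rank greater than one" = no order-embedding of the value group into
`ℝ≥0` (`IsEmpty O.valuation.RankLeOne`, Hölder); "`κ(V)/k` transcendental" =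
`Resolution.residueTrdeg k O _ ≠ 0`. Tree counterpart in the 2019 frame:
`Resolution.CossartPiltant2019Local.rankOne_reduction_of_cjs` (proved from
`CossartJannsenSaito2020General`). [cite: CossartPiltant2008, Prop 5.1 (HAL p. 16)] -/
def RankReduction : Prop :=
  ∀ (k K : Type u) [Field k] [Field K] [Algebra k K], (⊤ : IntermediateField k K).FG →
    Algebra.trdeg k K = 3 →
    ∀ (O : ValuationSubring K) (hk : ∀ c : k, algebraMap k K c ∈ O),
      (IsEmpty O.valuation.RankLeOne ∨ residueTrdeg k O hk ≠ 0) → IsLocallyUniformizable k K O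

/-- **Cossart–Piltant 2009, Main theorem** (pp. 1839–1840), VERBATIM: "Let `k` be a field of
positive characteristic which is differentially finite over a perfect field `k₀` … Let `S` be a
regular local ring of dimension three, essentially of finite type over `k` and such that
`K := QF(S)` has transcendance degree 3 over `k`. Let `R̄` be an Artin–Schreier or purely
inseparable singularity of dimension three over `S`" [`R̄ := (S[X]/(h))_{(X,u₁,u₂,u₃)}`,
`h := X^p − g^{p−1}X + f`, `h` irreducible over `QF(S)`, `f, g ∈ m_S`, `g ≠ 0` (resp. `g = 0`)].
"Let `K := QF(S)` and `L := QF(R̄)`. Then, each `k`-valuation `μ` of `L` dominating `R̄` and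
satisfying properties (i) and (ii) below has a local uniformization: (i) `μ` has rank one and
`κ(μ)/κ(S)` is algebraic; (ii) `μ` is the unique extension of its restriction to `K`."
Cossart–Piltant 2008, HAL pp. 3–4: this theorem IS the hypothesis of Thm 7.2 for `k`
differentially finite; rendered as exactly that (`ArtinSchreierHypothesis k`, which carries in
addition the immediacy of `W/V` from the hypothesis of Thm 7.2 — a further restriction, so this
Prop is implied by the printed theorem). [cite: CossartPiltant2009, Main theorem (pp. 1839–1840)] -/
def CossartPiltant2009Main : Prop :=
  ∀ (p : ℕ) [Fact p.Prime] (k : Type u) [Field k] [CharP k p], IsDifferentiallyFinite k →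
    ArtinSchreierHypothesis k

/-! ### Proved bookkeeping: the top-level reduction of Cossart–Piltant 2008 (HAL pp. 3–4, 16) -/

/-- The **trivial valuation ring** `O = K` of a finitely generated `K/k` is locally uniformizable:
its centre on the affine model `k[s] ⊆ K` (`s` a finite generating set) is the generic point,
whose local ring is a field, hence regular. [folklore] -/
theorem isLocallyUniformizable_top (k K : Type u) [Field k] [Field K] [Algebra k K]
    (hfg : (⊤ : IntermediateField k K).FG) : IsLocallyUniformizable k K ⊤ := by
  classical
  obtain ⟨s, hs⟩ := hfg
  have hfrac : IsFractionRing (Algebra.adjoin k (s : Set K)) K := by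
    refine IsFractionRing.of_field (Algebra.adjoin k (s : Set K)) K fun z => ?_
    have hz : z ∈ IntermediateField.adjoin k (s : Set K) := by
      rw [hs]; exact IntermediateField.mem_top
    obtain ⟨r, hr, t, ht, e⟩ := IntermediateField.mem_adjoin_iff_div.mp hz
    exact ⟨⟨r, hr⟩, ⟨t, ht⟩, e⟩
  have hle : (Algebra.adjoin k (s : Set K)).toSubring ≤ (⊤ : ValuationSubring K).toSubring :=
    fun x _ => ValuationSubring.mem_top x
  refine ⟨Algebra.adjoin k (s : Set K), hle, ⟨s, rfl⟩, hfrac, ?_⟩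
  have hF : IsField (⊤ : ValuationSubring K) :=
    { exists_pair_ne := ⟨0, 1, zero_ne_one⟩
      mul_comm := mul_comm
      mul_inv_cancel := by
        intro a ha
        refine ⟨⟨(a : K)⁻¹, ValuationSubring.mem_top _⟩, Subtype.ext ?_⟩
        change (a : K) * (a : K)⁻¹ = 1
        exact mul_inv_cancel₀ fun h => ha (Subtype.ext h) }
  have hmax : IsLocalRing.maximalIdeal (⊤ : ValuationSubring K) = ⊥ :=
    IsLocalRing.isField_iff_maximalIdeal_eq.mp hF
  have hinj : Function.Injective (Subring.inclusion hle) := by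
    intro a b hab
    have h := congrArg Subtype.val hab
    exact Subtype.ext h
  set P := Ideal.comap (Subring.inclusion hle)
    (IsLocalRing.maximalIdeal (⊤ : ValuationSubring K)) with hPdef
  have hP : P = ⊥ := by rw [hPdef, hmax, Ideal.comap_bot_of_injective _ hinj]
  have key : ∀ Q : Ideal (Algebra.adjoin k (s : Set K)).toSubring, Q = ⊥ →
      Q.map (algebraMap _ (Localization.AtPrime P)) = ⊥ := by
    rintro Q rfl; exact Ideal.map_bot
  have hF2 : IsField (Localization.AtPrime P) := by
    rw [IsLocalRing.isField_iff_maximalIdeal_eq,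
      ← IsLocalization.AtPrime.map_eq_maximalIdeal P (Localization.AtPrime P)]
    exact key P hP
  haveI := hF2.isPrincipalIdealRing
  infer_instance

/-- **Rank trichotomy** (Hölder): a valuation ring of a field is trivial, or of rank one (value
group nontrivial and embeddable in `ℝ≥0`), or of rank `> 1` (not embeddable). With Mathlib's
`Valuation.RankLeOne` (an order embedding into `ℝ≥0`, as data) and
`Valuation.RankOne = RankLeOne + IsNontrivial`. [folklore] -/
theorem rank_trichotomy {K : Type u} [Field K] (O : ValuationSubring K) :
    O = ⊤ ∨ Nonempty O.valuation.RankOne ∨ IsEmpty O.valuation.RankLeOne := by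
  by_cases hle : Nonempty O.valuation.RankLeOne
  · obtain ⟨hle⟩ := hle
    by_cases hnt : ∃ x : K, O.valuation x ≠ 0 ∧ O.valuation x ≠ 1
    · exact Or.inr (Or.inl ⟨{ toRankLeOne := hle, toIsNontrivial := ⟨hnt⟩ }⟩)
    · refine Or.inl ?_
      push Not at hnt
      ext x
      refine ⟨fun _ => ValuationSubring.mem_top x, fun _ => ?_⟩
      rw [← O.valuation_le_one_iff]
      by_cases hx : O.valuation x = 0
      · rw [hx]; exact zero_le
      · rw [hnt x hx]
  · exact Or.inr (Or.inr ⟨fun h => hle ⟨h⟩⟩)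

/-- The residue field of the trivial valuation ring does not matter: `⊤` is uniformizable
whatever `residueTrdeg` is; recorded as the form used in `lu3_of_leaves`. [folklore] -/
theorem isLocallyUniformizable_of_eq_top {k K : Type u} [Field k] [Field K] [Algebra k K]
    (hfg : (⊤ : IntermediateField k K).FG) {O : ValuationSubring K} (hO : O = ⊤) :
    IsLocallyUniformizable k K O := by
  subst hO; exact isLocallyUniformizable_top k K hfg

/-- **`LU3DiffFinite` from its leaves** — the architecture of Cossart–Piltant 2008 (HAL pp. 3–4 and
p. 16 "By proposition 5.1, one may furthermore assume that `V` has rank one and `κ(V)/k`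
algebraic"), PROVED: for `k` differentially finite of characteristic `p`, `K/k` of transcendence
degree three and a `k`-valuation ring `O` — if `O` has rank `> 1` or `κ(O)/k` is transcendental,
Prop 5.1; if `O` is trivial, `isLocallyUniformizable_top`; otherwise `O` has rank one and
`κ(O)/k` is algebraic, and Thm 7.2 fed with [CP2]'s Main theorem applies. [folklore] -/
theorem lu3_of_leaves (p51 : RankReduction.{u}) (t72 : ReductionToArtinSchreier.{u})
    (cp2 : CossartPiltant2009Main.{u}) : LU3DiffFinite.{u} := by
  intro p _ k _ _ hdf K _ _ hfg h3 O hk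
  by_cases halg : residueTrdeg k O hk = 0
  · rcases rank_trichotomy O with hO | h1 | hgt
    · exact isLocallyUniformizable_of_eq_top hfg hO
    · exact t72 k p (cp2 p k hdf) K hfg h3 O hk h1 halg
    · exact p51 k K hfg h3 O hk (Or.inl hgt)
  · exact p51 k K hfg h3 O hk (Or.inr halg)

/-- **PROVED edge**: `LU3DiffFinite` + Prop 4.9 ⟹ Thm 2.1 (i)(ii) on affine models of function
fields of transcendence degree three (HAL p. 3 "By proposition 4.9, it is sufficient to prove
local uniformization for any `k`-valuation ring `V/k` of `K(Z)/k`"). [folklore] -/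
theorem resolutionOfAffineModels_of_lu3 (hLU : LU3DiffFinite.{u}) (p49 : RefinedPatching.{u}) :
    ResolutionOfAffineModels.{u} := by
  intro p _ k _ _ hdf K _ _ hfg h3 A hA hfrac
  exact p49 k K hfg h3 (fun O hO => hLU p k hdf K hfg h3 O hO) A hA hfrac

/-- Thm 2.1 (i)(ii) on affine models from the paper's four leaves: Prop 4.9, Prop 5.1, Thm 7.2 and
[CP2]'s Main theorem. [folklore] -/
theorem resolutionOfAffineModels_of_leaves (p49 : RefinedPatching.{u}) (p51 : RankReduction.{u})
    (t72 : ReductionToArtinSchreier.{u}) (cp2 : CossartPiltant2009Main.{u}) :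
    ResolutionOfAffineModels.{u} :=
  resolutionOfAffineModels_of_lu3 (lu3_of_leaves p51 t72 cp2) p49

end Literature.AlgebraicGeometry.CossartPiltant200819.CP2008

end
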